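import Mathlib
import Summits.Ventures.DiscreteObjects.Mahler.SubLehmerDegreeTwentyTwo
import Summits.Ventures.DiscreteObjects.Mahler.CensusKernelDeg22Final
import Summits.Ventures.DiscreteObjects.Mahler.CensusRows22Kernel
import Summits.Ventures.DiscreteObjects.Mahler.CensusListedLehmerMinimum

/-!
# Lehmer's conjecture for every integer polynomial of degree ≤ 23, in the kernel (venture `DiscreteObjects`, target L)

Cell `pub-namedobj`, seat `pub-namedobj-mahler-g17`. Framing: lottery ticket; floor = certified bounds/negative ranges.

The degree-22 kernel census row `degreeCensus_twentytwo : DegreeCensus 22 (61/50) coresDeg22` (census search with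
Fejér–Riesz, resultant and kernel-certified explicit-auxiliary-function cuts at the bound `B = 61/50`, certified leaf
thresholds, trace–Graeffe certificates; `CensusKernelDeg22A … Final`) added to `SubLehmerDegreeTwentyTwo`:
* `degreeCensus_twentytwo_tight` — the same row with the tight exception list `[c22_01]` (`c22_01 = mrwPoly22(-x)`,
  `M = 1.20501985…`, the only listed degree-22 core below `61/50`; the other 47 are excluded by their kernel enclosures);
* `lehmer_le_of_irreducible_degree_twentytwo`, `lehmer_le_of_irreducible_of_natDegree_le_twentythree`,
  `lehmer_le_of_natDegree_le_twentythree` — every `P ∈ ℤ[X]` of degree `≤ 23` with `M(P) > 1` has `M(P) ≥ M(ℓ)`;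
* `minimalMeasure_degree_twentytwo` (MRW Table 1 row `D = 22`, no primitivity hypothesis needed: degree 22 has no
  imprimitive small-measure polynomial), `minimalMeasureByDegree_le_twentytwo`;
* `twentyfour_le_natDegree_of_subLehmer` — `1 < M(P) < M(ℓ)` forces `deg P ≥ 24`; rungs `N ≤ 23` of the cell's sub-Lehmer
  ladder and every `HeightCell h s d` with `d ≤ 23`, unconditionally;
* `kernelCensus_le_twentythree` — the census rows for every degree `1 … 23` (`13/10` for `n ≤ 21` and `n = 23`, `61/50` at `n = 22`).
CONTROL rows (published complete lists reach degree 44: Boyd 1980/1989, Mossinghoff 1998, Flammang–Rhin–Sac-Épée 2006,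
Mossinghoff–Rhin–Wu 2008; minimal measures by degree: MRW08 Table 1); kernel theorems with the standard axioms.
-/

namespace Summit.Ventures.DiscreteObjects.Mahler

open Polynomial Literature.NumberTheory.MahlerMeasure

/-- **Degree-22 census below `61/50` with the tight exception list:** every irreducible `P ∈ ℤ[X]` of degree `22` with
`1 < M(P) < 61/50` is `± c22_01(± x)` (`c22_01 = mrwPoly22(-x)`, `M = 1.20501985…`); the other 47 listed cores have
`M > 1.2295 > 61/50` by their kernel enclosures. -/
theorem degreeCensus_twentytwo_tight : DegreeCensus 22 (61 / 50) [c22_01] := by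
  intro p hdeg hirr h1 hB
  obtain ⟨l, hl, hform⟩ := degreeCensus_twentytwo p hdeg hirr h1 hB
  have hM := intMahlerMeasure_of_census_form hform
  refine ⟨c22_01, by simp, ?_⟩
  rw [hM] at hB
  simp only [coresDeg22, List.mem_cons, List.mem_nil_iff, or_false] at hl
  rcases hl with rfl | rfl | rfl | rfl | rfl | rfl | rfl | rfl | rfl | rfl | rfl | rfl | rfl | rfl | rfl | rfl | rfl | rfl | rfl | rfl | rfl | rfl | rfl | rfl | rfl | rfl | rfl | rfl | rfl | rfl | rfl | rfl | rfl | rfl | rfl | rfl | rfl | rfl | rfl | rfl | rfl | rfl | rfl | rfl | rfl | rfl | rfl | rfl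
  · exact hform
  · exact absurd hB (not_lt.mpr (le_of_lt (lt_of_le_of_lt (by norm_num) c22_02_measure_enclosure.1)))
  · exact absurd hB (not_lt.mpr (le_of_lt (lt_of_le_of_lt (by norm_num) c22_03_measure_enclosure.1)))
  · exact absurd hB (not_lt.mpr (le_of_lt (lt_of_le_of_lt (by norm_num) c22_04_measure_enclosure.1)))
  · exact absurd hB (not_lt.mpr (le_of_lt (lt_of_le_of_lt (by norm_num) c22_05_measure_enclosure.1)))
  · exact absurd hB (not_lt.mpr (le_of_lt (lt_of_le_of_lt (by norm_num) c22_06_measure_enclosure.1)))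
  · exact absurd hB (not_lt.mpr (le_of_lt (lt_of_le_of_lt (by norm_num) c22_07_measure_enclosure.1)))
  · exact absurd hB (not_lt.mpr (le_of_lt (lt_of_le_of_lt (by norm_num) c22_08_measure_enclosure.1)))
  · exact absurd hB (not_lt.mpr (le_of_lt (lt_of_le_of_lt (by norm_num) c22_09_measure_enclosure.1)))
  · exact absurd hB (not_lt.mpr (le_of_lt (lt_of_le_of_lt (by norm_num) c22_10_measure_enclosure.1)))
  · exact absurd hB (not_lt.mpr (le_of_lt (lt_of_le_of_lt (by norm_num) c22_11_measure_enclosure.1)))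
  · exact absurd hB (not_lt.mpr (le_of_lt (lt_of_le_of_lt (by norm_num) c22_12_measure_enclosure.1)))
  · exact absurd hB (not_lt.mpr (le_of_lt (lt_of_le_of_lt (by norm_num) c22_13_measure_enclosure.1)))
  · exact absurd hB (not_lt.mpr (le_of_lt (lt_of_le_of_lt (by norm_num) c22_14_measure_enclosure.1)))
  · exact absurd hB (not_lt.mpr (le_of_lt (lt_of_le_of_lt (by norm_num) c22_15_measure_enclosure.1)))
  · exact absurd hB (not_lt.mpr (le_of_lt (lt_of_le_of_lt (by norm_num) c22_16_measure_enclosure.1)))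
  · exact absurd hB (not_lt.mpr (le_of_lt (lt_of_le_of_lt (by norm_num) c22_17_measure_enclosure.1)))
  · exact absurd hB (not_lt.mpr (le_of_lt (lt_of_le_of_lt (by norm_num) c22_18_measure_enclosure.1)))
  · exact absurd hB (not_lt.mpr (le_of_lt (lt_of_le_of_lt (by norm_num) c22_19_measure_enclosure.1)))
  · exact absurd hB (not_lt.mpr (le_of_lt (lt_of_le_of_lt (by norm_num) c22_20_measure_enclosure.1)))
  · exact absurd hB (not_lt.mpr (le_of_lt (lt_of_le_of_lt (by norm_num) c22_21_measure_enclosure.1)))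
  · exact absurd hB (not_lt.mpr (le_of_lt (lt_of_le_of_lt (by norm_num) c22_22_measure_enclosure.1)))
  · exact absurd hB (not_lt.mpr (le_of_lt (lt_of_le_of_lt (by norm_num) c22_23_measure_enclosure.1)))
  · exact absurd hB (not_lt.mpr (le_of_lt (lt_of_le_of_lt (by norm_num) c22_24_measure_enclosure.1)))
  · exact absurd hB (not_lt.mpr (le_of_lt (lt_of_le_of_lt (by norm_num) c22_25_measure_enclosure.1)))
  · exact absurd hB (not_lt.mpr (le_of_lt (lt_of_le_of_lt (by norm_num) c22_26_measure_enclosure.1)))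
  · exact absurd hB (not_lt.mpr (le_of_lt (lt_of_le_of_lt (by norm_num) c22_27_measure_enclosure.1)))
  · exact absurd hB (not_lt.mpr (le_of_lt (lt_of_le_of_lt (by norm_num) c22_28_measure_enclosure.1)))
  · exact absurd hB (not_lt.mpr (le_of_lt (lt_of_le_of_lt (by norm_num) c22_29_measure_enclosure.1)))
  · exact absurd hB (not_lt.mpr (le_of_lt (lt_of_le_of_lt (by norm_num) c22_30_measure_enclosure.1)))
  · exact absurd hB (not_lt.mpr (le_of_lt (lt_of_le_of_lt (by norm_num) c22_31_measure_enclosure.1)))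
  · exact absurd hB (not_lt.mpr (le_of_lt (lt_of_le_of_lt (by norm_num) c22_32_measure_enclosure.1)))
  · exact absurd hB (not_lt.mpr (le_of_lt (lt_of_le_of_lt (by norm_num) c22_33_measure_enclosure.1)))
  · exact absurd hB (not_lt.mpr (le_of_lt (lt_of_le_of_lt (by norm_num) c22_34_measure_enclosure.1)))
  · exact absurd hB (not_lt.mpr (le_of_lt (lt_of_le_of_lt (by norm_num) c22_35_measure_enclosure.1)))
  · exact absurd hB (not_lt.mpr (le_of_lt (lt_of_le_of_lt (by norm_num) c22_36_measure_enclosure.1)))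
  · exact absurd hB (not_lt.mpr (le_of_lt (lt_of_le_of_lt (by norm_num) c22_37_measure_enclosure.1)))
  · exact absurd hB (not_lt.mpr (le_of_lt (lt_of_le_of_lt (by norm_num) c22_38_measure_enclosure.1)))
  · exact absurd hB (not_lt.mpr (le_of_lt (lt_of_le_of_lt (by norm_num) c22_39_measure_enclosure.1)))
  · exact absurd hB (not_lt.mpr (le_of_lt (lt_of_le_of_lt (by norm_num) c22_40_measure_enclosure.1)))
  · exact absurd hB (not_lt.mpr (le_of_lt (lt_of_le_of_lt (by norm_num) c22_41_measure_enclosure.1)))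
  · exact absurd hB (not_lt.mpr (le_of_lt (lt_of_le_of_lt (by norm_num) c22_42_measure_enclosure.1)))
  · exact absurd hB (not_lt.mpr (le_of_lt (lt_of_le_of_lt (by norm_num) c22_43_measure_enclosure.1)))
  · exact absurd hB (not_lt.mpr (le_of_lt (lt_of_le_of_lt (by norm_num) c22_44_measure_enclosure.1)))
  · exact absurd hB (not_lt.mpr (le_of_lt (lt_of_le_of_lt (by norm_num) c22_45_measure_enclosure.1)))
  · exact absurd hB (not_lt.mpr (le_of_lt (lt_of_le_of_lt (by norm_num) c22_46_measure_enclosure.1)))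
  · exact absurd hB (not_lt.mpr (le_of_lt (lt_of_le_of_lt (by norm_num) c22_47_measure_enclosure.1)))
  · exact absurd hB (not_lt.mpr (le_of_lt (lt_of_le_of_lt (by norm_num) c22_48_measure_enclosure.1)))

/-- An irreducible `P` of degree `22` with `M(P) > 1` has `M(P) ≥ M(ℓ)` (strictly: the listed degree-22 cores have `M > 1.205`). -/
theorem lehmer_le_of_irreducible_degree_twentytwo {P : ℤ[X]} (hirr : Irreducible P) (hdeg : P.natDegree = 22)
    (h1 : 1 < intMahlerMeasure P) : intMahlerMeasure lehmerPoly ≤ intMahlerMeasure P := by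
  have hL : intMahlerMeasure lehmerPoly < 11883 / 10 ^ 4 := lt_trans lehmer_measure_upper_bound (by norm_num)
  by_cases h : intMahlerMeasure P < 61 / 50
  · obtain ⟨l, hl, hform⟩ := degreeCensus_twentytwo P hdeg hirr h1 h
    rw [intMahlerMeasure_of_census_form hform]
    exact lehmer_le_census_listed l (by simp only [List.mem_append]; exact Or.inl (Or.inl (Or.inr hl)))
  · push Not at h
    exact le_trans (le_of_lt (lt_trans hL (by norm_num))) h

/-- **Degree 22 (MRW Table 1, D = 22):** an irreducible `P` of degree `22` with `M(P) > 1` has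
`M(P) ≥ M(mrwMinimalPoly 22) = 1.20501985…` (no primitivity hypothesis is needed at degree 22). -/
theorem minimalMeasure_degree_twentytwo {P : ℤ[X]} (hirr : Irreducible P) (hdeg : P.natDegree = 22)
    (h1 : 1 < intMahlerMeasure P) : intMahlerMeasure (mrwMinimalPoly 22) ≤ intMahlerMeasure P := by
  by_cases h : intMahlerMeasure P < 61 / 50
  · obtain ⟨l, hl, hform⟩ := degreeCensus_twentytwo P hdeg hirr h1 h
    rw [intMahlerMeasure_of_census_form hform]
    exact coresDeg22_min l hl
  · push Not at h
    have h22 : intMahlerMeasure (mrwMinimalPoly 22) < 61 / 50 :=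
      lt_trans mrwPoly22_measure_enclosure.2 (by norm_num)
    exact le_trans (le_of_lt h22) h

/-- **`MinimalMeasureByDegree` for `D ≤ 22` (proved):** for every even `8 ≤ D ≤ 22`, a PRIMITIVE irreducible integer
polynomial of degree `D` with `M > 1` has `M ≥ M(mrwMinimalPoly D)` — the `D = 8, …, 22` rows of MRW's Theorem 1.1 / Table 1
in the Literature file's own terms. -/
theorem minimalMeasureByDegree_le_twentytwo :
    ∀ D : ℕ, Even D → 8 ≤ D → D ≤ 22 →
      ∀ P : ℤ[X], Irreducible P → P.natDegree = D → 1 < (P.map (Int.castRingHom ℂ)).mahlerMeasure →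
        (∀ k : ℕ, 2 ≤ k → ∀ Q : ℤ[X], P ≠ expand ℤ k Q) →
          ((mrwMinimalPoly D).map (Int.castRingHom ℂ)).mahlerMeasure ≤ (P.map (Int.castRingHom ℂ)).mahlerMeasure := by
  intro D hD h8 h22 P hirr hdeg h1 hprim
  by_cases h20 : D ≤ 20
  · exact minimalMeasureByDegree_le_twenty D hD h8 h20 P hirr hdeg h1 hprim
  · have hD22 : D = 22 := by
      obtain ⟨k, rfl⟩ := hD; omega
    subst hD22
    exact minimalMeasure_degree_twentytwo hirr hdeg h1

/-- **Irreducible polynomials of degree `≤ 23` satisfy Lehmer's bound.** -/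
theorem lehmer_le_of_irreducible_of_natDegree_le_twentythree {P : ℤ[X]} (hirr : Irreducible P)
    (hdeg : P.natDegree ≤ 23) (h1 : 1 < intMahlerMeasure P) :
    intMahlerMeasure lehmerPoly ≤ intMahlerMeasure P := by
  by_cases h21 : P.natDegree ≤ 21
  · exact lehmer_le_of_irreducible_of_natDegree_le_twentyone hirr h21 h1
  by_cases hB : 61 / 50 ≤ intMahlerMeasure P
  · exact le_trans (le_of_lt (lt_trans lehmer_measure_upper_bound (by norm_num))) hB
  push Not at h21 hB
  have hθ : intMahlerMeasure P < smythTheta := lt_trans hB (lt_trans (by norm_num) smythTheta_gt)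
  obtain ⟨-, ⟨j, hj⟩, -⟩ := reciprocal_of_measure_lt_smythTheta hirr h1 hθ
  have hd : P.natDegree = 22 := by omega
  exact lehmer_le_of_irreducible_degree_twentytwo hirr hd h1

/-- **Lehmer's conjecture holds for every integer polynomial of degree `≤ 23`:** `M(P) > 1 ⇒ M(P) ≥ M(ℓ)`. -/
theorem lehmer_le_of_natDegree_le_twentythree {p : ℤ[X]} (hdeg : p.natDegree ≤ 23) (h1 : 1 < intMahlerMeasure p) :
    intMahlerMeasure lehmerPoly ≤ intMahlerMeasure p := by
  classical
  have hp : p ≠ 0 := by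
    intro h
    rw [h] at h1
    unfold intMahlerMeasure at h1
    rw [Polynomial.map_zero, mahlerMeasure_zero] at h1
    linarith
  obtain ⟨u, hu⟩ := UniqueFactorizationMonoid.factors_prod hp
  obtain ⟨c, hc, hcu⟩ := Polynomial.isUnit_iff.mp u.isUnit
  set F := UniqueFactorizationMonoid.factors p with hF
  have hFirr : ∀ f ∈ F, Irreducible f := fun f hf => UniqueFactorizationMonoid.irreducible_of_factor f hf
  have hMu : intMahlerMeasure (↑u : ℤ[X]) = 1 := by
    rw [← hcu, intMahlerMeasure_C]
    rcases Int.isUnit_iff.mp hc with h | h <;> simp [h]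
  have hMp : intMahlerMeasure p = (F.map intMahlerMeasure).prod := by
    rw [← hu, intMahlerMeasure_mul, hMu, mul_one, intMahlerMeasure_multiset_prod]
  have hdvd : ∀ f ∈ F, f ∣ p := fun f hf => (Multiset.dvd_prod hf).trans ⟨↑u, hu.symm⟩
  have hge1 : ∀ x ∈ F.map intMahlerMeasure, 1 ≤ x := by
    intro x hx
    obtain ⟨f, hf, rfl⟩ := Multiset.mem_map.mp hx
    exact one_le_intMahlerMeasure (hFirr f hf).ne_zero
  have hprod_ge : ∀ x ∈ F.map intMahlerMeasure, x ≤ (F.map intMahlerMeasure).prod := by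
    intro x hx
    obtain ⟨T, hT⟩ := Multiset.exists_cons_of_mem hx
    rw [hT, Multiset.prod_cons]
    have hT1 : 1 ≤ T.prod :=
      Multiset.one_le_prod (fun y hy => hge1 y (by rw [hT]; exact Multiset.mem_cons_of_mem hy))
    have hx0 : 0 ≤ x := le_trans zero_le_one (hge1 x hx)
    nlinarith
  by_contra hlt
  push Not at hlt
  have hall : ∀ x ∈ F.map intMahlerMeasure, x = 1 := by
    intro x hx
    obtain ⟨f, hf, rfl⟩ := Multiset.mem_map.mp hx
    by_contra hne
    have hgt : 1 < intMahlerMeasure f := lt_of_le_of_ne (hge1 _ hx) (Ne.symm hne)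
    have hfdeg : f.natDegree ≤ 23 := (natDegree_le_of_dvd (hdvd f hf) hp).trans hdeg
    have h2 := lehmer_le_of_irreducible_of_natDegree_le_twentythree (hFirr f hf) hfdeg hgt
    have h3 := hprod_ge _ hx
    rw [← hMp] at h3
    linarith
  have : (F.map intMahlerMeasure).prod = 1 := Multiset.prod_eq_one hall
  rw [← hMp] at this
  linarith

/-- **A sub-Lehmer polynomial has degree at least `24`.** -/
theorem twentyfour_le_natDegree_of_subLehmer {P : ℤ[X]} (hP : SubLehmer P) : 24 ≤ P.natDegree := by
  by_contra h
  push Not at h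
  have := lehmer_le_of_natDegree_le_twentythree (p := P) (by omega) hP.1
  exact absurd hP.2 (not_lt.mpr this)

/-- Census rows in the engines' format, degrees `≤ 23`, below Lehmer's measure: nothing. -/
theorem heightBoundedCensus_subLehmer_of_le_twentythree {n h : ℕ} (hn : n ≤ 23) :
    HeightBoundedCensus n h (intMahlerMeasure lehmerPoly) [] := by
  refine ⟨fun p hdeg _ h1 h2 => ?_, fun l hl => by simp at hl⟩
  exfalso
  have := lehmer_le_of_natDegree_le_twentythree (p := p) (by omega) h1
  linarith

/-- **Rungs `N ≤ 23` of the sub-Lehmer ladder, unconditionally, at every height bound `h`.** -/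
theorem heightSubLehmerEmptyUpTo_of_le_twentythree (h : ℕ) {N : ℕ} (hN : N ≤ 23) : HeightSubLehmerEmptyUpTo h N := by
  intro P hdeg _ hP
  have := twentyfour_le_natDegree_of_subLehmer hP
  omega

/-- Height-1 rungs `N ≤ 23`, unconditionally. -/
theorem height1SubLehmerEmptyUpTo_of_le_twentythree {N : ℕ} (hN : N ≤ 23) : Height1SubLehmerEmptyUpTo N :=
  (heightSubLehmerEmptyUpTo_one_iff N).mp (heightSubLehmerEmptyUpTo_of_le_twentythree 1 hN)

/-- Every cell `HeightCell h s d` with core degree `d ≤ 23` holds unconditionally. -/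
theorem heightCell_of_le_twentythree (h : ℕ) (s : Multiset ℕ) {d : ℕ} (hd : d ≤ 23) : HeightCell h s d := by
  intro Q hdeg _ _ _ _ _ hQ
  have := twentyfour_le_natDegree_of_subLehmer hQ
  omega

/-- **The kernel census of small Mahler measures, degrees `1 … 23`:** the rows of `kernelCensus_le_twentyone` (bound `13/10`,
degrees `≤ 21`), the degree-22 row at the bound `61/50` (tight: `c22_01` only) and the empty row of the odd degree `23`. -/
theorem kernelCensus_le_twentythree :
    (DegreeCensus 8 (13 / 10) coresDeg8 ∧ DegreeCensus 10 (13 / 10) coresDeg10 ∧ DegreeCensus 12 (13 / 10) coresDeg12 ∧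
      DegreeCensus 14 (13 / 10) coresDeg14 ∧ DegreeCensus 16 (13 / 10) coresDeg16 ∧ DegreeCensus 18 (13 / 10) coresDeg18 ∧
      DegreeCensus 20 (13 / 10) coresDeg20 ∧
      ∀ n : ℕ, 1 ≤ n → n ≤ 21 → n ≠ 8 → n ≠ 10 → n ≠ 12 → n ≠ 14 → n ≠ 16 → n ≠ 18 → n ≠ 20 →
        DegreeCensus n (13 / 10) []) ∧
    DegreeCensus 22 (61 / 50) [c22_01] ∧ DegreeCensus 23 (13 / 10) [] := by
  refine ⟨kernelCensus_le_twentyone, degreeCensus_twentytwo_tight, ?_⟩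
  have hθ : (13 : ℝ) / 10 ≤ smythTheta := le_of_lt (lt_trans (by norm_num) smythTheta_gt)
  exact degreeCensus_odd_smythTheta (by decide) hθ

end Summit.Ventures.DiscreteObjects.Mahler
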